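import Mathlib
import HarnessLib

/-!
# HodgeLocusCensusSurfaceFermatColumns — the Fermat column of the SURFACE census cells (2,d,0), 6 ≤ d ≤ 12, in closed form: a UNIFORM certificate, coverings, inter-kernel constants (cell pub-hlocus, LEAD seat ivhs-1, gen 23)
HONEST FRAMING: certified instances and evidence bearing on the general Hodge conjecture; no claim.

SETTING (record `data/ivhs/census/og81/MU0-SURFACES-g23.md`, files `pub-hlocus-ivhs-1/gen23/`; continuation of `HodgeLocusCensusSurfaceCharts` (d = 5, 6; gen 22)).
X_F = Fermat surface of degree d in ℙ³; L = {x₀ = ζx₁, x₂ = ζx₃}, L' = {x₀ = ζx₁, x₂ = ζ³x₃} (ζ = z = ζ_{2d}; the census pair `standard_pair(2,d,0,[1])`: two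
coplanar lines); γ_λ = [L] + λ[L']; V_λ its Hodge-locus (Noether–Lefschetz) germ at X_F; N = NL(L ∪ L') (smooth, codimension 2d − 6); Λ the census monomial
complement of T_{X_F}N (|Λ| = 2(d − 3); the tangent map of V_λ on Λ has rank |Λ| − 1 for λ ≠ 0, free column #0 = x^(0,2,0,d−2) or #1 = x^(0,2,1,d−3)).
ENGINE C (`gen23/symC_fermat.py --kernel A`): engine A's period kernel split into its [L]- and [L']-parts (every Taylor coefficient is affine in λ), then EXACT
elimination over ℚ(ζ_{2d})[λ] — kernel vector by maximal minors (it is affine in λ), second-order term, Schur complements; no sampling, no interpolation —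
gives engine A's chart certificate, the FERMAT column [t_f² t_n⁰] x^β (λ), as an exact rational function of λ; ENGINE D (`--kernel B`) runs the same elimination on
the raw Griffiths–Dwork Taylor coefficients of engine B (`code/engineB`, Villaflor's P_δ).  Checks: on (2,6,0) both reproduce the gen-22 SAMPLED reconstructions of
engines A and B string-for-string; for (2,7,0) and (2,8,0) the sampled line-chart reconstructions of this generation (kit job, `gen23/sym/SYM{A,B}_{270,280}_*.json`)
are the third and fourth routes.  RESULT, uniform in d for 6 ≤ d ≤ 12, both kernels, both charts: the Fermat exceptional set is E_F = {0, 1}, and in engine A's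
normalisation the certificate of the row β = (0, d−6, 2, 0) is
      chart free-0:  [t_f² t_n⁰](λ) = (1 − z²)³/(2d) · λ(1 − λ)/(λ − z^(d−4))²,        chart free-1:  [t_f² t_n⁰](λ) = z⁶(1 − z²)³/(2d) · λ(1 − λ)/(λ − z^(d−2))²,
while engine B's printed certificate (row (d−6, 0, 0, 2)) is (−d²·z^(2d−10)) times engine A's in both charts (d = 6: −36ω, the gen-22 constant).
READING (gen 22 / referee R88): where a chart is valid (λ ≠ its pole) and its certificate is non-zero, the transverse slice V_λ ∩ Λ at the Fermat point is a
fat point of length exactly 2, so μ₀(2,d,0; λ) ≤ 2 (slice semicontinuity along N), hence = 2 by Dan's strict excess at every surface through two coplanar lines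
(tree: `Literature.AlgebraicGeometry.Kloosterman2025.coplanarLines_idealDegree_inf_lt`); the two charts cover every λ ∉ {0, 1} since z^(d−4) ≠ z^(d−2).
(For d = 5 the second-order obstruction vanishes identically: the Fermat quintic is a special point of N for every λ, MU0-SURFACES-g22 §2.)
WHAT THE KERNEL CHECKS (K any field of characteristic 0): the uniform functions `certF0`, `certF1` and their non-vanishing off {0, 1, pole}, vanishing at 0 and 1,
distinct poles and the COVERING `cover` for any z with z ≠ 0, z² ≠ 1 and any non-zero constant; for each d = 7, …, 12 with z a root of Φ_{2d}: z ≠ 0 and z² ≠ 1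
(Bezout), the engine's PRINTED reduced numerators and denominators equal the uniform ones modulo Φ_{2d} (`printedC2d0`), the covering instance `cover2d0`, and the
printed engine-D constants = (−d²·z^(2d−10)) × engine C's (`printedD2d0`); `d6_link` recovers the gen-22 forms of (2,6,0) ((1 − z²)³ = −1 = z⁶ for z = ζ₁₂).
NOT FORMALISED: the computation itself (Python, exact), the passage to μ₀, all Hodge theory.  Nothing here is a statement about the Hodge conjecture.
-/

namespace Summit.HodgeConjecture.HodgeConjecture.HodgeLocus.Census.SurfaceFermatColumns

variable {K : Type*} [Field K] [CharZero K]

/-! ## The uniform certificate functions (engine A normalisation, row β = (0, d−6, 2, 0)); c stands for 2d, p for the pole exponent -/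

/-- chart free-0: (1 − z²)³/c · λ(1 − λ)/(λ − z^p)²  (c = 2d, p = d − 4). -/
def certF0 (c : K) (p : ℕ) (z lam : K) : K := (1 - z ^ 2) ^ 3 / c * lam * (1 - lam) / (lam - z ^ p) ^ 2

/-- chart free-1: z⁶(1 − z²)³/c · λ(1 − λ)/(λ − z^p)²  (c = 2d, p = d − 2). -/
def certF1 (c : K) (p : ℕ) (z lam : K) : K := z ^ 6 * (1 - z ^ 2) ^ 3 / c * lam * (1 - lam) / (lam - z ^ p) ^ 2

omit [CharZero K] in
/-- the chart-free-0 certificate is non-zero off {0, 1, z^p} when z² ≠ 1 and c ≠ 0. -/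
theorem certF0_ne_zero {c : K} (hc : c ≠ 0) (p : ℕ) {z lam : K} (hz2 : z ^ 2 ≠ 1) (h0 : lam ≠ 0) (h1 : lam ≠ 1)
    (h : lam ≠ z ^ p) : certF0 c p z lam ≠ 0 := by
  unfold certF0
  have hu : (1 - z ^ 2) ^ 3 ≠ 0 := pow_ne_zero _ (sub_ne_zero.mpr (Ne.symm hz2))
  exact div_ne_zero (mul_ne_zero (mul_ne_zero (div_ne_zero hu hc) h0) (sub_ne_zero.mpr (Ne.symm h1)))
    (pow_ne_zero _ (sub_ne_zero.mpr h))

omit [CharZero K] in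
/-- the chart-free-1 certificate is non-zero off {0, 1, z^p} when z ≠ 0, z² ≠ 1 and c ≠ 0. -/
theorem certF1_ne_zero {c : K} (hc : c ≠ 0) (p : ℕ) {z lam : K} (hz0 : z ≠ 0) (hz2 : z ^ 2 ≠ 1) (h0 : lam ≠ 0)
    (h1 : lam ≠ 1) (h : lam ≠ z ^ p) : certF1 c p z lam ≠ 0 := by
  unfold certF1
  have hu : z ^ 6 * (1 - z ^ 2) ^ 3 ≠ 0 :=
    mul_ne_zero (pow_ne_zero _ hz0) (pow_ne_zero _ (sub_ne_zero.mpr (Ne.symm hz2)))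
  exact div_ne_zero (mul_ne_zero (mul_ne_zero (div_ne_zero hu hc) h0) (sub_ne_zero.mpr (Ne.symm h1)))
    (pow_ne_zero _ (sub_ne_zero.mpr h))

omit [CharZero K] in
/-- both certificates vanish at λ = 0 (the single line: V₀ = NL(L) ⊋ N) and λ = 1 (γ₁ = the class of a plane conic: V₁ = NL(conic) ⊋ N, EXPLAINED-SMOOTH). -/
theorem certF_zero_at (c : K) (p q : ℕ) (z : K) :
    certF0 c p z 0 = 0 ∧ certF0 c p z 1 = 0 ∧ certF1 c q z 0 = 0 ∧ certF1 c q z 1 = 0 := by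
  simp [certF0, certF1]

omit [CharZero K] in
/-- the two chart poles differ: z^p ≠ z^(p+2) when z ≠ 0 and z² ≠ 1. -/
theorem poles_ne (p : ℕ) {z : K} (hz0 : z ≠ 0) (hz2 : z ^ 2 ≠ 1) : z ^ p ≠ z ^ (p + 2) := by
  intro h
  have h' : z ^ p * (z ^ 2 - 1) = 0 := by rw [pow_add] at h; linear_combination -h
  rcases mul_eq_zero.mp h' with h2 | h2
  · exact (pow_ne_zero _ hz0) h2
  · exact hz2 (sub_eq_zero.mp h2)

omit [CharZero K] in
/-- COVERING: for every λ ∉ {0, 1} one of the two charts is valid at λ (λ ≠ its pole) with a non-zero certificate.  With c = 2d, p = d − 4 this is the statement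
'the Fermat slice of V_λ has length exactly 2, hence μ₀(2,d,0; λ) ≤ 2, for every λ ∉ {0, 1}' of the record, granted the computation. -/
theorem cover {c : K} (hc : c ≠ 0) (p : ℕ) {z : K} (hz0 : z ≠ 0) (hz2 : z ^ 2 ≠ 1) (lam : K) (h0 : lam ≠ 0) (h1 : lam ≠ 1) :
    (lam ≠ z ^ p ∧ certF0 c p z lam ≠ 0) ∨ (lam ≠ z ^ (p + 2) ∧ certF1 c (p + 2) z lam ≠ 0) := by
  by_cases h : lam = z ^ p
  · right
    have h' : lam ≠ z ^ (p + 2) := by rw [h]; exact poles_ne p hz0 hz2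
    exact ⟨h', certF1_ne_zero hc (p + 2) hz0 hz2 h0 h1 h'⟩
  · left; exact ⟨h, certF0_ne_zero hc p hz2 h0 h1 h⟩

omit [CharZero K] in
/-- d = 6 link with `HodgeLocusCensusSurfaceCharts` (gen 22): for z = ζ₁₂ (Φ₁₂(z) = z⁴ − z² + 1 = 0), (1 − z²)³ = −1 and z⁶ = −1, so with ω = z² the uniform
forms are (1/12)·λ(λ − 1)/(λ − ω)² (chart free-0) and (1/12)·λ(1 − λ)/(λ − z⁴)², z⁴ = ω − 1 (chart free-1): the gen-22 certificates `certA260c0`, `certA260c1`. -/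
theorem d6_link {z : K} (hz : z ^ 4 - z ^ 2 + 1 = 0) : (1 - z ^ 2) ^ 3 = -1 ∧ z ^ 6 = -1 ∧ z ^ 4 = z ^ 2 - 1 := by
  refine ⟨?_, ?_, ?_⟩
  · linear_combination (-z ^ 2 + 2) * hz
  · linear_combination (z ^ 2 + 1) * hz
  · linear_combination hz

/-! ## Cell (2,7,0): z = ζ_14 (Φ_14(z) = 0), c = 14, poles z ^ 3 (chart free-0) and z ^ 5 (chart free-1) -/

/-- a root z of Φ_14 (characteristic 0) satisfies z ≠ 0 and z² ≠ 1 (Bezout modulo Φ_14). -/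
theorem z_facts14 {z : K} (hz : (1 - z + z ^ 2 - z ^ 3 + z ^ 4 - z ^ 5 + z ^ 6 : K) = 0) : z ≠ 0 ∧ z ^ 2 ≠ 1 := by
  refine ⟨?_, ?_⟩
  · intro h; rw [h] at hz; norm_num at hz
  · intro h
    have key : (1 : K) = 0 := by
      linear_combination (((-3 - z - 2 * z ^ 2 - 2 * z ^ 3 - z ^ 4 - 3 * z ^ 5 : K) / 7)) * h + (((4 + 3 * z : K) / 7)) * hz
    exact one_ne_zero key

/-- engine C's PRINTED reduced output for (2,7,0) (`sym/SYMC_2_7_0_fermat.json`, rows [tf^2 tn^0] x^0120 in both charts) equals the uniform form modulo Φ_14: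
numerator constants of charts free-0, free-1 and the two monic denominators. -/
theorem printedC270 {z : K} (hz : (1 - z + z ^ 2 - z ^ 3 + z ^ 4 - z ^ 5 + z ^ 6 : K) = 0) (lam : K) :
    (((2 - z - 2 * z ^ 2 - z ^ 3 + 4 * z ^ 4 - z ^ 5 : K) / 14) = (1 - z ^ 2) ^ 3 / 14) ∧
    (((-1 + 4 * z - z ^ 2 - 2 * z ^ 3 - z ^ 4 + 2 * z ^ 5 : K) / 14) = z ^ 6 * (1 - z ^ 2) ^ 3 / 14) ∧
    (lam ^ 2 + (-2 * z ^ 3 : K) * lam + (-1 + z - z ^ 2 + z ^ 3 - z ^ 4 + z ^ 5 : K) = (lam - z ^ 3) ^ 2) ∧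
    (lam ^ 2 + (-2 * z ^ 5 : K) * lam + (-z ^ 3 : K) = (lam - z ^ 5) ^ 2) := by
  refine ⟨?_, ?_, ?_, ?_⟩
  · linear_combination (((1 : K) / 14)) * hz
  · linear_combination (((-1 + 3 * z + 3 * z ^ 2 - 3 * z ^ 3 - 3 * z ^ 4 + z ^ 5 + z ^ 6 : K) / 14)) * hz
  · linear_combination ((-1 : K)) * hz
  · linear_combination ((-z ^ 3 - z ^ 4 : K)) * hz

/-- COVERING instance for (2,7,0): for every λ ∉ {0, 1} one chart is valid with a non-zero Fermat-column certificate. -/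
theorem cover270 {z : K} (hz : (1 - z + z ^ 2 - z ^ 3 + z ^ 4 - z ^ 5 + z ^ 6 : K) = 0) (lam : K) (h0 : lam ≠ 0) (h1 : lam ≠ 1) :
    (lam ≠ z ^ 3 ∧ certF0 14 3 z lam ≠ 0) ∨ (lam ≠ z ^ 5 ∧ certF1 14 5 z lam ≠ 0) :=
  cover (by norm_num) 3 (z_facts14 hz).1 (z_facts14 hz).2 lam h0 h1

/-- engine D's PRINTED numerator constants for (2,7,0) (`sym/SYMD_2_7_0_fermat.json`, rows [tf^2 tn^0] x^1002; kernel B) are (−7²·z^4) × the uniform engine-C constants,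
charts free-0 and free-1 (the denominators are the same squares). -/
theorem printedD270 {z : K} (hz : (1 - z + z ^ 2 - z ^ 3 + z ^ 4 - z ^ 5 + z ^ 6 : K) = 0) :
    (((-21 + 42 * z - 21 * z ^ 2 + 14 * z ^ 3 - 28 * z ^ 4 + 21 * z ^ 5 : K) / 2) = (-49 * z ^ 4 : K) * ((1 - z ^ 2) ^ 3 / 14)) ∧
    (((-21 + 7 * z ^ 2 + 7 * z ^ 3 - 21 * z ^ 5 : K) / 2) = (-49 * z ^ 4 : K) * (z ^ 6 * (1 - z ^ 2) ^ 3 / 14)) := by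
  refine ⟨?_, ?_⟩
  · linear_combination (((-21 + 21 * z + 21 * z ^ 2 - 7 * z ^ 3 - 7 * z ^ 4 : K) / 2)) * hz
  · linear_combination (((-21 - 21 * z + 7 * z ^ 2 + 14 * z ^ 3 + 7 * z ^ 4 - 21 * z ^ 5 - 21 * z ^ 6 + 21 * z ^ 7 + 21 * z ^ 8 - 7 * z ^ 9 - 7 * z ^ 10 : K) / 2)) * hz

/-! ## Cell (2,8,0): z = ζ_16 (Φ_16(z) = 0), c = 16, poles z ^ 4 (chart free-0) and z ^ 6 (chart free-1) -/

/-- a root z of Φ_16 (characteristic 0) satisfies z ≠ 0 and z² ≠ 1 (Bezout modulo Φ_16). -/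
theorem z_facts16 {z : K} (hz : (1 + z ^ 8 : K) = 0) : z ≠ 0 ∧ z ^ 2 ≠ 1 := by
  refine ⟨?_, ?_⟩
  · intro h; rw [h] at hz; norm_num at hz
  · intro h
    have key : (1 : K) = 0 := by
      linear_combination (((-1 - z ^ 2 - z ^ 4 - z ^ 6 : K) / 2)) * h + (((1 : K) / 2)) * hz
    exact one_ne_zero key

/-- engine C's PRINTED reduced output for (2,8,0) (`sym/SYMC_2_8_0_fermat.json`, rows [tf^2 tn^0] x^0220 in both charts) equals the uniform form modulo Φ_16:
numerator constants of charts free-0, free-1 and the two monic denominators. -/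
theorem printedC280 {z : K} (hz : (1 + z ^ 8 : K) = 0) (lam : K) :
    (((1 - 3 * z ^ 2 + 3 * z ^ 4 - z ^ 6 : K) / 16) = (1 - z ^ 2) ^ 3 / 16) ∧
    (((3 - 3 * z ^ 2 + z ^ 4 + z ^ 6 : K) / 16) = z ^ 6 * (1 - z ^ 2) ^ 3 / 16) ∧
    (lam ^ 2 + (-2 * z ^ 4 : K) * lam + (-1 : K) = (lam - z ^ 4) ^ 2) ∧
    (lam ^ 2 + (-2 * z ^ 6 : K) * lam + (-z ^ 4 : K) = (lam - z ^ 6) ^ 2) := by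
  refine ⟨?_, ?_, ?_, ?_⟩
  · linear_combination ((0 : K)) * hz
  · linear_combination (((3 - 3 * z ^ 2 + z ^ 4 : K) / 16)) * hz
  · linear_combination ((-1 : K)) * hz
  · linear_combination ((-z ^ 4 : K)) * hz

/-- COVERING instance for (2,8,0): for every λ ∉ {0, 1} one chart is valid with a non-zero Fermat-column certificate. -/
theorem cover280 {z : K} (hz : (1 + z ^ 8 : K) = 0) (lam : K) (h0 : lam ≠ 0) (h1 : lam ≠ 1) :
    (lam ≠ z ^ 4 ∧ certF0 16 4 z lam ≠ 0) ∨ (lam ≠ z ^ 6 ∧ certF1 16 6 z lam ≠ 0) :=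
  cover (by norm_num) 4 (z_facts16 hz).1 (z_facts16 hz).2 lam h0 h1

/-- engine D's PRINTED numerator constants for (2,8,0) (`sym/SYMD_2_8_0_fermat.json`, rows [tf^2 tn^0] x^2002; kernel B) are (−8²·z^6) × the uniform engine-C constants,
charts free-0 and free-1 (the denominators are the same squares). -/
theorem printedD280 {z : K} (hz : (1 + z ^ 8 : K) = 0) :
    ((-12 + 12 * z ^ 2 - 4 * z ^ 4 - 4 * z ^ 6 : K) = (-64 * z ^ 6 : K) * ((1 - z ^ 2) ^ 3 / 16)) ∧
    ((-12 + 4 * z ^ 2 + 4 * z ^ 4 - 12 * z ^ 6 : K) = (-64 * z ^ 6 : K) * (z ^ 6 * (1 - z ^ 2) ^ 3 / 16)) := by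
  refine ⟨?_, ?_⟩
  · linear_combination ((-12 + 12 * z ^ 2 - 4 * z ^ 4 : K)) * hz
  · linear_combination ((-12 + 4 * z ^ 2 + 4 * z ^ 4 - 12 * z ^ 6 + 12 * z ^ 8 - 4 * z ^ 10 : K)) * hz

/-! ## Cell (2,9,0): z = ζ_18 (Φ_18(z) = 0), c = 18, poles z ^ 5 (chart free-0) and z ^ 7 (chart free-1) -/

/-- a root z of Φ_18 (characteristic 0) satisfies z ≠ 0 and z² ≠ 1 (Bezout modulo Φ_18). -/
theorem z_facts18 {z : K} (hz : (1 - z ^ 3 + z ^ 6 : K) = 0) : z ≠ 0 ∧ z ^ 2 ≠ 1 := by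
  refine ⟨?_, ?_⟩
  · intro h; rw [h] at hz; norm_num at hz
  · intro h
    have key : (1 : K) = 0 := by
      linear_combination (((-1 + z - z ^ 2 - z ^ 3 - 2 * z ^ 4 - z ^ 5 : K) / 3)) * h + (((2 + z : K) / 3)) * hz
    exact one_ne_zero key

/-- engine C's PRINTED reduced output for (2,9,0) (`sym/SYMC_2_9_0_fermat.json`, rows [tf^2 tn^0] x^0320 in both charts) equals the uniform form modulo Φ_18:
numerator constants of charts free-0, free-1 and the two monic denominators. -/
theorem printedC290 {z : K} (hz : (1 - z ^ 3 + z ^ 6 : K) = 0) (lam : K) :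
    (((2 - 3 * z ^ 2 - z ^ 3 + 3 * z ^ 4 : K) / 18) = (1 - z ^ 2) ^ 3 / 18) ∧
    (((-1 - 3 * z + 3 * z ^ 2 + 2 * z ^ 3 - 3 * z ^ 5 : K) / 18) = z ^ 6 * (1 - z ^ 2) ^ 3 / 18) ∧
    (lam ^ 2 + (-2 * z ^ 5 : K) * lam + (-z : K) = (lam - z ^ 5) ^ 2) ∧
    (lam ^ 2 + (2 * z - 2 * z ^ 4 : K) * lam + (-z ^ 5 : K) = (lam - z ^ 7) ^ 2) := by
  refine ⟨?_, ?_, ?_, ?_⟩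
  · linear_combination (((1 : K) / 18)) * hz
  · linear_combination (((-1 - 3 * z + 3 * z ^ 2 + z ^ 3 - 3 * z ^ 4 + z ^ 6 : K) / 18)) * hz
  · linear_combination ((-z - z ^ 4 : K)) * hz
  · linear_combination ((-z ^ 5 - z ^ 8 : K) + (2 * z : K) * lam) * hz

/-- COVERING instance for (2,9,0): for every λ ∉ {0, 1} one chart is valid with a non-zero Fermat-column certificate. -/
theorem cover290 {z : K} (hz : (1 - z ^ 3 + z ^ 6 : K) = 0) (lam : K) (h0 : lam ≠ 0) (h1 : lam ≠ 1) :
    (lam ≠ z ^ 5 ∧ certF0 18 5 z lam ≠ 0) ∨ (lam ≠ z ^ 7 ∧ certF1 18 7 z lam ≠ 0) :=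
  cover (by norm_num) 5 (z_facts18 hz).1 (z_facts18 hz).2 lam h0 h1

/-- engine D's PRINTED numerator constants for (2,9,0) (`sym/SYMD_2_9_0_fermat.json`, rows [tf^2 tn^0] x^3002; kernel B) are (−9²·z^8) × the uniform engine-C constants,
charts free-0 and free-1 (the denominators are the same squares). -/
theorem printedD290 {z : K} (hz : (1 - z ^ 3 + z ^ 6 : K) = 0) :
    (((-27 * z + 9 * z ^ 2 + 27 * z ^ 3 - 18 * z ^ 5 : K) / 2) = (-81 * z ^ 8 : K) * ((1 - z ^ 2) ^ 3 / 18)) ∧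
    (((-27 + 27 * z + 9 * z ^ 2 - 27 * z ^ 4 + 9 * z ^ 5 : K) / 2) = (-81 * z ^ 8 : K) * (z ^ 6 * (1 - z ^ 2) ^ 3 / 18)) := by
  refine ⟨?_, ?_⟩
  · linear_combination (((-27 * z + 9 * z ^ 2 + 27 * z ^ 3 - 27 * z ^ 4 - 9 * z ^ 5 + 27 * z ^ 6 - 9 * z ^ 8 : K) / 2)) * hz
  · linear_combination (((-27 + 27 * z + 9 * z ^ 2 - 27 * z ^ 3 + 18 * z ^ 5 - 27 * z ^ 7 + 9 * z ^ 8 + 27 * z ^ 9 - 27 * z ^ 10 - 9 * z ^ 11 + 27 * z ^ 12 - 9 * z ^ 14 : K) / 2)) * hz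

/-! ## Cell (2,10,0): z = ζ_20 (Φ_20(z) = 0), c = 20, poles z ^ 6 (chart free-0) and z ^ 8 (chart free-1) -/

/-- a root z of Φ_20 (characteristic 0) satisfies z ≠ 0 and z² ≠ 1 (Bezout modulo Φ_20). -/
theorem z_facts20 {z : K} (hz : (1 - z ^ 2 + z ^ 4 - z ^ 6 + z ^ 8 : K) = 0) : z ≠ 0 ∧ z ^ 2 ≠ 1 := by
  refine ⟨?_, ?_⟩
  · intro h; rw [h] at hz; norm_num at hz
  · intro h
    have key : (1 : K) = 0 := by
      linear_combination ((-z ^ 2 - z ^ 6 : K)) * h + ((1 : K)) * hz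
    exact one_ne_zero key

/-- engine C's PRINTED reduced output for (2,10,0) (`sym/SYMC_2_10_0_fermat.json`, rows [tf^2 tn^0] x^0420 in both charts) equals the uniform form modulo Φ_20:
numerator constants of charts free-0, free-1 and the two monic denominators. -/
theorem printedC2100 {z : K} (hz : (1 - z ^ 2 + z ^ 4 - z ^ 6 + z ^ 8 : K) = 0) (lam : K) :
    (((1 - 3 * z ^ 2 + 3 * z ^ 4 - z ^ 6 : K) / 20) = (1 - z ^ 2) ^ 3 / 20) ∧
    (((-2 * z ^ 2 + 3 * z ^ 4 - 2 * z ^ 6 : K) / 20) = z ^ 6 * (1 - z ^ 2) ^ 3 / 20) ∧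
    (lam ^ 2 + (-2 * z ^ 6 : K) * lam + (-z ^ 2 : K) = (lam - z ^ 6) ^ 2) ∧
    (lam ^ 2 + (2 - 2 * z ^ 2 + 2 * z ^ 4 - 2 * z ^ 6 : K) * lam + (-z ^ 6 : K) = (lam - z ^ 8) ^ 2) := by
  refine ⟨?_, ?_, ?_, ?_⟩
  · linear_combination ((0 : K)) * hz
  · linear_combination (((-2 * z ^ 2 + z ^ 4 : K) / 20)) * hz
  · linear_combination ((-z ^ 2 - z ^ 4 : K)) * hz
  · linear_combination ((-z ^ 6 - z ^ 8 : K) + (2 : K) * lam) * hz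

/-- COVERING instance for (2,10,0): for every λ ∉ {0, 1} one chart is valid with a non-zero Fermat-column certificate. -/
theorem cover2100 {z : K} (hz : (1 - z ^ 2 + z ^ 4 - z ^ 6 + z ^ 8 : K) = 0) (lam : K) (h0 : lam ≠ 0) (h1 : lam ≠ 1) :
    (lam ≠ z ^ 6 ∧ certF0 20 6 z lam ≠ 0) ∨ (lam ≠ z ^ 8 ∧ certF1 20 8 z lam ≠ 0) :=
  cover (by norm_num) 6 (z_facts20 hz).1 (z_facts20 hz).2 lam h0 h1

/-- engine D's PRINTED numerator constants for (2,10,0) (`sym/SYMD_2_10_0_fermat.json`, rows [tf^2 tn^0] x^4002; kernel B) are (−10²·z^10) × the uniform engine-C constants,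
charts free-0 and free-1 (the denominators are the same squares). -/
theorem printedD2100 {z : K} (hz : (1 - z ^ 2 + z ^ 4 - z ^ 6 + z ^ 8 : K) = 0) :
    ((5 - 15 * z ^ 2 + 15 * z ^ 4 - 5 * z ^ 6 : K) = (-100 * z ^ 10 : K) * ((1 - z ^ 2) ^ 3 / 20)) ∧
    ((-10 * z ^ 2 + 15 * z ^ 4 - 10 * z ^ 6 : K) = (-100 * z ^ 10 : K) * (z ^ 6 * (1 - z ^ 2) ^ 3 / 20)) := by
  refine ⟨?_, ?_⟩
  · linear_combination ((5 - 10 * z ^ 2 + 10 * z ^ 6 - 5 * z ^ 8 : K)) * hz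
  · linear_combination ((-10 * z ^ 2 + 5 * z ^ 4 + 5 * z ^ 6 - 10 * z ^ 8 + 10 * z ^ 12 - 5 * z ^ 14 : K)) * hz

/-! ## Cell (2,11,0): z = ζ_22 (Φ_22(z) = 0), c = 22, poles z ^ 7 (chart free-0) and z ^ 9 (chart free-1) -/

/-- a root z of Φ_22 (characteristic 0) satisfies z ≠ 0 and z² ≠ 1 (Bezout modulo Φ_22). -/
theorem z_facts22 {z : K} (hz : (1 - z + z ^ 2 - z ^ 3 + z ^ 4 - z ^ 5 + z ^ 6 - z ^ 7 + z ^ 8 - z ^ 9 + z ^ 10 : K) = 0) : z ≠ 0 ∧ z ^ 2 ≠ 1 := by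
  refine ⟨?_, ?_⟩
  · intro h; rw [h] at hz; norm_num at hz
  · intro h
    have key : (1 : K) = 0 := by
      linear_combination (((-5 - z - 4 * z ^ 2 - 2 * z ^ 3 - 3 * z ^ 4 - 3 * z ^ 5 - 2 * z ^ 6 - 4 * z ^ 7 - z ^ 8 - 5 * z ^ 9 : K) / 11)) * h + (((6 + 5 * z : K) / 11)) * hz
    exact one_ne_zero key

/-- engine C's PRINTED reduced output for (2,11,0) (`sym/SYMC_2_11_0_fermat.json`, rows [tf^2 tn^0] x^0520 in both charts) equals the uniform form modulo Φ_22: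
numerator constants of charts free-0, free-1 and the two monic denominators. -/
theorem printedC2110 {z : K} (hz : (1 - z + z ^ 2 - z ^ 3 + z ^ 4 - z ^ 5 + z ^ 6 - z ^ 7 + z ^ 8 - z ^ 9 + z ^ 10 : K) = 0) (lam : K) :
    (((1 - 3 * z ^ 2 + 3 * z ^ 4 - z ^ 6 : K) / 22) = (1 - z ^ 2) ^ 3 / 22) ∧
    (((-3 + 4 * z - 3 * z ^ 2 + 3 * z ^ 3 - 3 * z ^ 4 + 3 * z ^ 5 - 2 * z ^ 6 + 3 * z ^ 7 - 6 * z ^ 8 + 3 * z ^ 9 : K) / 22) = z ^ 6 * (1 - z ^ 2) ^ 3 / 22) ∧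
    (lam ^ 2 + (-2 * z ^ 7 : K) * lam + (-z ^ 3 : K) = (lam - z ^ 7) ^ 2) ∧
    (lam ^ 2 + (-2 * z ^ 9 : K) * lam + (-z ^ 7 : K) = (lam - z ^ 9) ^ 2) := by
  refine ⟨?_, ?_, ?_, ?_⟩
  · linear_combination ((0 : K)) * hz
  · linear_combination (((-3 + z + z ^ 2 : K) / 22)) * hz
  · linear_combination ((-z ^ 3 - z ^ 4 : K)) * hz
  · linear_combination ((-z ^ 7 - z ^ 8 : K)) * hz

/-- COVERING instance for (2,11,0): for every λ ∉ {0, 1} one chart is valid with a non-zero Fermat-column certificate. -/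
theorem cover2110 {z : K} (hz : (1 - z + z ^ 2 - z ^ 3 + z ^ 4 - z ^ 5 + z ^ 6 - z ^ 7 + z ^ 8 - z ^ 9 + z ^ 10 : K) = 0) (lam : K) (h0 : lam ≠ 0) (h1 : lam ≠ 1) :
    (lam ≠ z ^ 7 ∧ certF0 22 7 z lam ≠ 0) ∨ (lam ≠ z ^ 9 ∧ certF1 22 9 z lam ≠ 0) :=
  cover (by norm_num) 7 (z_facts22 hz).1 (z_facts22 hz).2 lam h0 h1

/-- engine D's PRINTED numerator constants for (2,11,0) (`sym/SYMD_2_11_0_fermat.json`, rows [tf^2 tn^0] x^5002; kernel B) are (−11²·z^12) × the uniform engine-C constants,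
charts free-0 and free-1 (the denominators are the same squares). -/
theorem printedD2110 {z : K} (hz : (1 - z + z ^ 2 - z ^ 3 + z ^ 4 - z ^ 5 + z ^ 6 - z ^ 7 + z ^ 8 - z ^ 9 + z ^ 10 : K) = 0) :
    (((11 * z - 33 * z ^ 3 + 33 * z ^ 5 - 11 * z ^ 7 : K) / 2) = (-121 * z ^ 12 : K) * ((1 - z ^ 2) ^ 3 / 22)) ∧
    (((-33 + 11 * z ^ 2 + 11 * z ^ 7 - 33 * z ^ 9 : K) / 2) = (-121 * z ^ 12 : K) * (z ^ 6 * (1 - z ^ 2) ^ 3 / 22)) := by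
  refine ⟨?_, ?_⟩
  · linear_combination (((11 * z + 11 * z ^ 2 - 33 * z ^ 3 - 33 * z ^ 4 + 33 * z ^ 5 + 33 * z ^ 6 - 11 * z ^ 7 - 11 * z ^ 8 : K) / 2)) * hz
  · linear_combination (((-33 - 33 * z + 11 * z ^ 2 + 11 * z ^ 3 + 11 * z ^ 7 + 11 * z ^ 8 - 33 * z ^ 9 - 33 * z ^ 10 + 33 * z ^ 11 + 33 * z ^ 12 - 11 * z ^ 13 - 11 * z ^ 14 : K) / 2)) * hz

/-! ## Cell (2,12,0): z = ζ_24 (Φ_24(z) = 0), c = 24, poles z ^ 8 (chart free-0) and z ^ 10 (chart free-1) -/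

/-- a root z of Φ_24 (characteristic 0) satisfies z ≠ 0 and z² ≠ 1 (Bezout modulo Φ_24). -/
theorem z_facts24 {z : K} (hz : (1 - z ^ 4 + z ^ 8 : K) = 0) : z ≠ 0 ∧ z ^ 2 ≠ 1 := by
  refine ⟨?_, ?_⟩
  · intro h; rw [h] at hz; norm_num at hz
  · intro h
    have key : (1 : K) = 0 := by
      linear_combination ((-z ^ 4 - z ^ 6 : K)) * h + ((1 : K)) * hz
    exact one_ne_zero key

/-- engine C's PRINTED reduced output for (2,12,0) (`sym/SYMC_2_12_0_fermat.json`, rows [tf^2 tn^0] x^0620 in both charts) equals the uniform form modulo Φ_24: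
numerator constants of charts free-0, free-1 and the two monic denominators. -/
theorem printedC2120 {z : K} (hz : (1 - z ^ 4 + z ^ 8 : K) = 0) (lam : K) :
    (((1 - 3 * z ^ 2 + 3 * z ^ 4 - z ^ 6 : K) / 24) = (1 - z ^ 2) ^ 3 / 24) ∧
    (((4 - 3 * z ^ 2 - 3 * z ^ 4 + 4 * z ^ 6 : K) / 24) = z ^ 6 * (1 - z ^ 2) ^ 3 / 24) ∧
    (lam ^ 2 + (2 - 2 * z ^ 4 : K) * lam + (-z ^ 4 : K) = (lam - z ^ 8) ^ 2) ∧
    (lam ^ 2 + (2 * z ^ 2 - 2 * z ^ 6 : K) * lam + (1 - z ^ 4 : K) = (lam - z ^ 10) ^ 2) := by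
  refine ⟨?_, ?_, ?_, ?_⟩
  · linear_combination ((0 : K)) * hz
  · linear_combination (((4 - 3 * z ^ 2 + z ^ 4 : K) / 24)) * hz
  · linear_combination ((-z ^ 4 - z ^ 8 : K) + (2 : K) * lam) * hz
  · linear_combination ((1 - z ^ 8 - z ^ 12 : K) + (2 * z ^ 2 : K) * lam) * hz

/-- COVERING instance for (2,12,0): for every λ ∉ {0, 1} one chart is valid with a non-zero Fermat-column certificate. -/
theorem cover2120 {z : K} (hz : (1 - z ^ 4 + z ^ 8 : K) = 0) (lam : K) (h0 : lam ≠ 0) (h1 : lam ≠ 1) :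
    (lam ≠ z ^ 8 ∧ certF0 24 8 z lam ≠ 0) ∨ (lam ≠ z ^ 10 ∧ certF1 24 10 z lam ≠ 0) :=
  cover (by norm_num) 8 (z_facts24 hz).1 (z_facts24 hz).2 lam h0 h1

/-- engine D's PRINTED numerator constants for (2,12,0) (`sym/SYMD_2_12_0_fermat.json`, rows [tf^2 tn^0] x^6002; kernel B) are (−12²·z^14) × the uniform engine-C constants,
charts free-0 and free-1 (the denominators are the same squares). -/
theorem printedD2120 {z : K} (hz : (1 - z ^ 4 + z ^ 8 : K) = 0) :
    ((6 + 6 * z ^ 2 - 24 * z ^ 4 + 18 * z ^ 6 : K) = (-144 * z ^ 14 : K) * ((1 - z ^ 2) ^ 3 / 24)) ∧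
    ((-24 + 24 * z ^ 2 + 6 * z ^ 4 - 18 * z ^ 6 : K) = (-144 * z ^ 14 : K) * (z ^ 6 * (1 - z ^ 2) ^ 3 / 24)) := by
  refine ⟨?_, ?_⟩
  · linear_combination ((6 + 6 * z ^ 2 - 18 * z ^ 4 + 24 * z ^ 6 - 24 * z ^ 8 + 18 * z ^ 10 - 6 * z ^ 12 : K)) * hz
  · linear_combination ((-24 + 24 * z ^ 2 - 18 * z ^ 4 + 6 * z ^ 6 + 6 * z ^ 8 - 18 * z ^ 10 + 24 * z ^ 12 - 24 * z ^ 14 + 18 * z ^ 16 - 6 * z ^ 18 : K)) * hz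

end Summit.HodgeConjecture.HodgeConjecture.HodgeLocus.Census.SurfaceFermatColumns
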